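import Summits.Ventures.LatticeQCDFlow.Exactness.Phi4FlowSamplerErgodic
import HarnessLib

/-!
# Sticking: where the flow's tails are lighter than `e^{−S}` the exact φ⁴ flow sampler has no uniform rate

HONEST FRAMING: exact (Metropolis-corrected) sampling algorithms for lattice gauge theory;
figures of merit are autocorrelation/cost numbers at stated couplings and volumes; no
continuum-physics claim.  (SCALAR calibration rung S0-A: not a gauge result.)

Venture `LatticeQCDFlow` (cell pub-lqcd), topic `Exactness`; FANOUT row 2 (`s0-phi4`, FLOW arm).
NEW WORK of the cell; the converse-direction companion of `Exactness/Phi4FlowSamplerErgodic.lean`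
(bounded normalised weight `W` ⇒ exact AND uniformly ergodic at rate `(1 − W⁻¹)ᵗ`).  Built on row
30's holding bound `imhAcceptMass_le` (`A(x) ≤ Z/w(x)`, `Exactness/IMHKernel.lean`).  Printed
counterpart NAMED ONLY: Mengersen–Tweedie 1996, Ann. Statist. 24, Thm 2.1 (necessity half: an
unbounded weight rules out uniform — indeed geometric — ergodicity); only the elementary
uniform-ergodicity obstruction is formalised here, nothing is cited as a fact.

## What is proved

* General state space with measurable singletons, any Markov kernel `κ`:
  `bind_apply_singleton_ge` / `iterate_bind_apply_singleton_ge` — `(κ(x,{x}))ᵗ · m{x} ≤ (mκᵗ){x}`;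
  for the flow-MCMC kernel `indepMH q w`: `indepMH_apply_singleton_ge` — the chain holds at `x`
  with probability `≥ 1 − A(x)` (rejection mass), hence **`indepMH_iterate_dirac_singleton_ge`**:
  started AT `x`, it is still at `x` after `t` steps with probability `≥ (1 − A(x))ᵗ`.
* The lattice (`ℝ^Λ`, `λ > 0`, any real `J`, positive model density `q̃`, `∫ q̃ = 1`), with the
  model-to-target ratio `ρ(φ) = Z q̃(φ) e^{S(φ)}` (`= (normalised weight)⁻¹`;
  `lintegral_flowModel_weight`: `∫ (e^{−S}/q̃) dq̃ = Z`): **`phi4FlowSampler_sticking`** — from `φ₀` with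
  `ρ(φ₀) ≤ 1` the sampler is still at `φ₀` after `t` steps with probability `≥ (1 − ρ(φ₀))ᵗ`, and
  (`_linear`, no side condition) `≥ 1 − t ρ(φ₀)`, while `π{φ₀} = 0`
  (`phi4GibbsMeasure_singleton`); **`phi4FlowSampler_not_uniformly_ergodic`** — if the model's
  tails are lighter than the target's somewhere, `inf_φ ρ(φ) = 0` (stated as
  `∀ η > 0, ∃ φ, Z q̃(φ) ≤ η e^{−S(φ)}`), then there is NO `r < 1` with `|μKᵗ(A) − π(A)| ≤ rᵗ` for
  all initial laws: the chain is exact (row 2, `imh_exact_phi4`) but not uniformly ergodic.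

Reading for S0-A: an affine-coupling flow with bounded log-scales has a Gaussian minorant and the
companion file's rate applies; a model that can shrink its output tails below `e^{−λΣφ⁴}` in some
direction pays with configurations it cannot leave for `≳ 1/ρ` steps — exactness is kept, the cost
moves into the autocorrelation time.  NOT CLAIMED: failure of GEOMETRIC ergodicity (the full
Mengersen–Tweedie converse), or that any trained S0-A network is in either regime.
-/

namespace Summit.Ventures.LatticeQCDFlow.Exactness

open MeasureTheory ProbabilityTheory Real Finset
open scoped ENNReal

/-! ## §1. Holding at a point: general state space -/

section General

variable {Ω : Type*} [MeasurableSpace Ω] [MeasurableSingletonClass Ω]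

/-- One step of any Markov kernel keeps at least `κ(x,{x}) · m{x}` of the mass sitting at `x`. -/
theorem bind_apply_singleton_ge (κ : Kernel Ω Ω) (m : Measure Ω) (x : Ω) :
    κ x {x} * m {x} ≤ (m.bind κ) {x} := by
  rw [Measure.bind_apply (measurableSet_singleton x) (Kernel.aemeasurable κ)]
  calc κ x {x} * m {x} = ∫⁻ y in {x}, κ y {x} ∂m := by rw [lintegral_singleton]
    _ ≤ ∫⁻ y, κ y {x} ∂m := setLIntegral_le_lintegral _ _

/-- Iterated: `(κ(x,{x}))ᵗ · m{x} ≤ (m κᵗ)({x})`. -/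
theorem iterate_bind_apply_singleton_ge (κ : Kernel Ω Ω) (x : Ω) :
    ∀ (t : ℕ) (m : Measure Ω),
      (κ x {x}) ^ t * m {x} ≤ ((fun ν : Measure Ω => ν.bind κ)^[t] m) {x}
  | 0, m => by simp
  | t + 1, m => by
    rw [Function.iterate_succ_apply, pow_succ', mul_assoc]
    calc κ x {x} * ((κ x {x}) ^ t * m {x})
        ≤ (κ x {x}) ^ t * (κ x {x} * m {x}) := by rw [← mul_assoc, mul_comm (κ x {x}), mul_assoc]
      _ ≤ (κ x {x}) ^ t * (m.bind κ) {x} := by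
          gcongr
          exact bind_apply_singleton_ge κ m x
      _ ≤ ((fun ν : Measure Ω => ν.bind κ)^[t] (m.bind κ)) {x} :=
          iterate_bind_apply_singleton_ge κ x t (m.bind κ)

variable {q : Measure Ω} [IsProbabilityMeasure q] {w : Ω → ℝ}

/-- **Holding.**  From `x` the flow-MCMC chain stays at `x` with probability at least its rejection
mass `1 − A(x)`. -/
theorem indepMH_apply_singleton_ge (hw : Measurable w) (x : Ω) :
    1 - imhAcceptMass q w x ≤ indepMH q w x {x} := by
  rw [indepMH_apply hw x (measurableSet_singleton x), Set.indicator_of_mem (Set.mem_singleton x),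
    Pi.one_apply, mul_one]
  exact le_add_self

/-- **Started at `x`, still at `x` after `t` steps with probability `≥ (1 − A(x))ᵗ`.** -/
theorem indepMH_iterate_dirac_singleton_ge (hw : Measurable w) (x : Ω) (t : ℕ) :
    (1 - imhAcceptMass q w x) ^ t
      ≤ ((fun ν : Measure Ω => ν.bind (indepMH q w))^[t] (Measure.dirac x)) {x} := by
  calc (1 - imhAcceptMass q w x) ^ t ≤ (indepMH q w x {x}) ^ t :=
        pow_le_pow_left' (indepMH_apply_singleton_ge hw x) t
    _ = (indepMH q w x {x}) ^ t * Measure.dirac x {x} := by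
        rw [Measure.dirac_apply_of_mem (Set.mem_singleton x), mul_one]
    _ ≤ _ := iterate_bind_apply_singleton_ge (indepMH q w) x t (Measure.dirac x)

/-- Real-valued form with the weight: if `∫ w dq = Z < ∞` then, started at `x`, the chain is still
at `x` after `t` steps with probability `≥ 1 − t · Z/w(x)`. -/
theorem indepMH_iterate_dirac_singleton_real_ge (hw : Measurable w) (hw0 : ∀ x, 0 < w x)
    {Z : ℝ} (hZ0 : 0 ≤ Z) (hZ : ∫⁻ y, ENNReal.ofReal (w y) ∂q = ENNReal.ofReal Z) (x : Ω) (t : ℕ) :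
    1 - t * (Z / w x)
      ≤ ((fun ν : Measure Ω => ν.bind (indepMH q w))^[t] (Measure.dirac x)).real {x} := by
  haveI : Fact (Measurable w) := ⟨hw⟩
  -- the acceptance mass in real terms
  have hA1 : imhAcceptMass q w x ≤ 1 := imhAcceptMass_le_one q w x
  have hAtop : imhAcceptMass q w x ≠ ⊤ := ne_top_of_le_ne_top ENNReal.one_ne_top hA1
  have hAle : (imhAcceptMass q w x).toReal ≤ Z / w x := by
    have h := imhAcceptMass_le (q := q) hw0 x
    rw [hZ, ← ENNReal.ofReal_mul (inv_nonneg.2 (hw0 x).le)] at h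
    have h2 := ENNReal.toReal_mono ENNReal.ofReal_ne_top h
    rw [ENNReal.toReal_ofReal (mul_nonneg (inv_nonneg.2 (hw0 x).le) hZ0)] at h2
    calc (imhAcceptMass q w x).toReal ≤ (w x)⁻¹ * Z := h2
      _ = Z / w x := by rw [div_eq_inv_mul]
  have hA0 : 0 ≤ (imhAcceptMass q w x).toReal := ENNReal.toReal_nonneg
  have hAle1 : (imhAcceptMass q w x).toReal ≤ 1 := by
    have := ENNReal.toReal_mono ENNReal.one_ne_top hA1
    rwa [ENNReal.toReal_one] at this
  -- the iterate is a probability law, so its values are finite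
  have hprob : ∀ (s : ℕ) (m : Measure Ω) [IsProbabilityMeasure m],
      IsProbabilityMeasure ((fun ν : Measure Ω => ν.bind (indepMH q w))^[s] m) := by
    intro s
    induction s with
    | zero => intro m hm; simpa using hm
    | succ s ihs =>
      intro m hm
      rw [Function.iterate_succ_apply']
      haveI := ihs m
      exact ⟨by rw [Measure.bind_apply MeasurableSet.univ (Kernel.aemeasurable _)]; simp⟩
  haveI := hprob t (Measure.dirac x)
  have h := indepMH_iterate_dirac_singleton_ge (q := q) hw x t
  have h2 := ENNReal.toReal_mono (measure_ne_top _ _) h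
  rw [ENNReal.toReal_pow, ENNReal.toReal_sub_of_le hA1 ENNReal.one_ne_top, ENNReal.toReal_one] at h2
  -- Bernoulli: `1 − t a ≤ (1 − a)ᵗ` for `0 ≤ a ≤ 1`
  have hB : 1 - t * (imhAcceptMass q w x).toReal ≤ (1 - (imhAcceptMass q w x).toReal) ^ t := by
    have h := one_add_mul_le_pow (a := -(imhAcceptMass q w x).toReal) (by linarith) t
    calc 1 - t * (imhAcceptMass q w x).toReal = 1 + t * (-(imhAcceptMass q w x).toReal) := by ring
      _ ≤ (1 + -(imhAcceptMass q w x).toReal) ^ t := h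
      _ = (1 - (imhAcceptMass q w x).toReal) ^ t := by rw [← sub_eq_add_neg]
  calc 1 - t * (Z / w x) ≤ 1 - t * (imhAcceptMass q w x).toReal := by
        gcongr
    _ ≤ (1 - (imhAcceptMass q w x).toReal) ^ t := hB
    _ ≤ _ := h2

/-- Power form: if moreover `Z ≤ w(x)`, still at `x` after `t` steps with probability
`≥ (1 − Z/w(x))ᵗ`. -/
theorem indepMH_iterate_dirac_singleton_real_ge_pow (hw : Measurable w) (hw0 : ∀ x, 0 < w x)
    {Z : ℝ} (hZ0 : 0 ≤ Z) (hZ : ∫⁻ y, ENNReal.ofReal (w y) ∂q = ENNReal.ofReal Z) (x : Ω)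
    (hZx : Z ≤ w x) (t : ℕ) :
    (1 - Z / w x) ^ t
      ≤ ((fun ν : Measure Ω => ν.bind (indepMH q w))^[t] (Measure.dirac x)).real {x} := by
  haveI : Fact (Measurable w) := ⟨hw⟩
  have hA1 : imhAcceptMass q w x ≤ 1 := imhAcceptMass_le_one q w x
  have hAle : (imhAcceptMass q w x).toReal ≤ Z / w x := by
    have h := imhAcceptMass_le (q := q) hw0 x
    rw [hZ, ← ENNReal.ofReal_mul (inv_nonneg.2 (hw0 x).le)] at h
    have h2 := ENNReal.toReal_mono ENNReal.ofReal_ne_top h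
    rw [ENNReal.toReal_ofReal (mul_nonneg (inv_nonneg.2 (hw0 x).le) hZ0)] at h2
    calc (imhAcceptMass q w x).toReal ≤ (w x)⁻¹ * Z := h2
      _ = Z / w x := by rw [div_eq_inv_mul]
  have hρ1 : Z / w x ≤ 1 := (div_le_one (hw0 x)).2 hZx
  have hprob : ∀ (s : ℕ) (m : Measure Ω) [IsProbabilityMeasure m],
      IsProbabilityMeasure ((fun ν : Measure Ω => ν.bind (indepMH q w))^[s] m) := by
    intro s
    induction s with
    | zero => intro m hm; simpa using hm
    | succ s ihs =>
      intro m hm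
      rw [Function.iterate_succ_apply']
      haveI := ihs m
      exact ⟨by rw [Measure.bind_apply MeasurableSet.univ (Kernel.aemeasurable _)]; simp⟩
  haveI := hprob t (Measure.dirac x)
  have h := indepMH_iterate_dirac_singleton_ge (q := q) hw x t
  have h2 := ENNReal.toReal_mono (measure_ne_top _ _) h
  rw [ENNReal.toReal_pow, ENNReal.toReal_sub_of_le hA1 ENNReal.one_ne_top, ENNReal.toReal_one] at h2
  calc (1 - Z / w x) ^ t ≤ (1 - (imhAcceptMass q w x).toReal) ^ t := by
        apply pow_le_pow_left₀ (by linarith)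
        linarith
    _ ≤ _ := h2

end General

/-! ## §2. The lattice: sticking of the φ⁴ flow sampler and the absence of a uniform rate -/

section Lattice

open Summit.Ventures.LatticeQCDFlow.Scoring

variable {n : ℕ}

/-- The total weight of the model law against the code's weight `e^{−S}/q̃` is `Z = ∫ e^{−S}`. -/
theorem lintegral_flowModel_weight {lam : ℝ} (hlam : 0 < lam) (J : Fin (n + 1) → Fin (n + 1) → ℝ)
    {q : (Fin (n + 1) → ℝ) → ℝ} (hq0 : ∀ φ, 0 < q φ) (hqm : Measurable q) :
    ∫⁻ φ, ENNReal.ofReal (gibbsWeight J lam φ / q φ) ∂(flowModel q)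
      = ENNReal.ofReal (gibbsZ J lam) := by
  have hg : Measurable fun φ => ENNReal.ofReal (gibbsWeight J lam φ / q φ) :=
    ((continuous_gibbsWeight J lam).measurable.div hqm).ennreal_ofReal
  rw [flowModel, lintegral_withDensity_eq_lintegral_mul _ hqm.ennreal_ofReal hg]
  have e : (fun φ => ENNReal.ofReal (q φ)) * (fun φ => ENNReal.ofReal (gibbsWeight J lam φ / q φ))
      = fun φ => ENNReal.ofReal (gibbsWeight J lam φ) := by
    funext φ
    simp only [Pi.mul_apply]
    rw [← ENNReal.ofReal_mul (hq0 φ).le, mul_div_cancel₀ _ (hq0 φ).ne']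
  rw [e, ← ofReal_integral_eq_lintegral_ofReal (integrable_gibbsWeight hlam J)
    (Filter.Eventually.of_forall fun φ => (gibbsWeight_pos J lam φ).le)]
  rfl

/-- **The Gibbs law charges no configuration**: `π{φ₀} = 0` (Lebesgue). -/
theorem phi4GibbsMeasure_singleton (J : Fin (n + 1) → Fin (n + 1) → ℝ) (lam : ℝ)
    (φ₀ : Fin (n + 1) → ℝ) : phi4GibbsMeasure J lam {φ₀} = 0 :=
  withDensity_absolutelyContinuous _ _ (measure_singleton φ₀)

/-- **STICKING OF THE φ⁴ FLOW SAMPLER (linear form).**  `λ > 0`, any real `J`, any positive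
measurable model density `q̃` with `∫ q̃ = 1`.  Started at a configuration `φ₀`, the sampler is
still at `φ₀` after `t` steps with probability at least `1 − t ρ(φ₀)`,
`ρ(φ₀) = Z q̃(φ₀)/e^{−S(φ₀)}` — although the target gives `{φ₀}` probability zero. -/
theorem phi4FlowSampler_sticking_linear {lam : ℝ} (hlam : 0 < lam)
    (J : Fin (n + 1) → Fin (n + 1) → ℝ) {q : (Fin (n + 1) → ℝ) → ℝ} (hq0 : ∀ φ, 0 < q φ)
    (hqm : Measurable q) (hqi : Integrable q) (hq1 : ∫ φ, q φ = 1) (φ₀ : Fin (n + 1) → ℝ)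
    (t : ℕ) :
    haveI := isProbabilityMeasure_flowModel hq0 hqi hq1
    1 - t * (gibbsZ J lam * q φ₀ / gibbsWeight J lam φ₀)
      ≤ ((fun ν : Measure (Fin (n + 1) → ℝ) => ν.bind (phi4FlowKernel J lam q))^[t]
          (Measure.dirac φ₀)).real {φ₀} := by
  haveI := isProbabilityMeasure_flowModel hq0 hqi hq1
  have hwm : Measurable fun φ => gibbsWeight J lam φ / q φ :=
    (continuous_gibbsWeight J lam).measurable.div hqm
  have h := indepMH_iterate_dirac_singleton_real_ge (q := flowModel q)
    (w := fun φ => gibbsWeight J lam φ / q φ) hwm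
    (fun φ => div_pos (gibbsWeight_pos J lam φ) (hq0 φ)) (gibbsZ_pos hlam J).le
    (lintegral_flowModel_weight hlam J hq0 hqm) φ₀ t
  have e : gibbsZ J lam / (gibbsWeight J lam φ₀ / q φ₀)
      = gibbsZ J lam * q φ₀ / gibbsWeight J lam φ₀ := by
    rw [div_div_eq_mul_div]
  beta_reduce at h
  rw [e] at h
  exact h

/-- **STICKING OF THE φ⁴ FLOW SAMPLER (power form).**  If `ρ(φ₀) = Z q̃(φ₀) e^{S(φ₀)} ≤ 1` then the
sampler started at `φ₀` is still there after `t` steps with probability `≥ (1 − ρ(φ₀))ᵗ`: it holds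
for `≳ 1/ρ(φ₀)` steps wherever the model under-covers the target. -/
theorem phi4FlowSampler_sticking {lam : ℝ} (hlam : 0 < lam)
    (J : Fin (n + 1) → Fin (n + 1) → ℝ) {q : (Fin (n + 1) → ℝ) → ℝ} (hq0 : ∀ φ, 0 < q φ)
    (hqm : Measurable q) (hqi : Integrable q) (hq1 : ∫ φ, q φ = 1) (φ₀ : Fin (n + 1) → ℝ)
    (hρ : gibbsZ J lam * q φ₀ ≤ gibbsWeight J lam φ₀) (t : ℕ) :
    haveI := isProbabilityMeasure_flowModel hq0 hqi hq1
    (1 - gibbsZ J lam * q φ₀ / gibbsWeight J lam φ₀) ^ t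
      ≤ ((fun ν : Measure (Fin (n + 1) → ℝ) => ν.bind (phi4FlowKernel J lam q))^[t]
          (Measure.dirac φ₀)).real {φ₀} := by
  haveI := isProbabilityMeasure_flowModel hq0 hqi hq1
  have hZx : gibbsZ J lam ≤ gibbsWeight J lam φ₀ / q φ₀ := by
    rw [le_div_iff₀ (hq0 φ₀)]
    exact hρ
  have hwm : Measurable fun φ => gibbsWeight J lam φ / q φ :=
    (continuous_gibbsWeight J lam).measurable.div hqm
  have h := indepMH_iterate_dirac_singleton_real_ge_pow (q := flowModel q)
    (w := fun φ => gibbsWeight J lam φ / q φ) hwm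
    (fun φ => div_pos (gibbsWeight_pos J lam φ) (hq0 φ)) (gibbsZ_pos hlam J).le
    (lintegral_flowModel_weight hlam J hq0 hqm) φ₀ hZx t
  have e : gibbsZ J lam / (gibbsWeight J lam φ₀ / q φ₀)
      = gibbsZ J lam * q φ₀ / gibbsWeight J lam φ₀ := by
    rw [div_div_eq_mul_div]
  beta_reduce at h
  rw [e] at h
  exact h

/-- **NO UNIFORM RATE WHEN THE MODEL'S TAILS ARE LIGHTER THAN THE TARGET'S.**  `λ > 0`, any real
`J`, positive measurable model density with `∫ q̃ = 1`.  If `inf_φ Z q̃(φ) e^{S(φ)} = 0` — for every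
`η > 0` some configuration has `Z q̃(φ) ≤ η e^{−S(φ)}` — then there is no `r < 1` with
`|μKᵗ(A) − π(A)| ≤ rᵗ` for all initial laws `μ`, all `t`, all sets `A`: the exact flow sampler is
NOT uniformly ergodic (contrast `phi4FlowSampler_uniformly_ergodic`). -/
theorem phi4FlowSampler_not_uniformly_ergodic {lam : ℝ} (hlam : 0 < lam)
    (J : Fin (n + 1) → Fin (n + 1) → ℝ) {q : (Fin (n + 1) → ℝ) → ℝ} (hq0 : ∀ φ, 0 < q φ)
    (hqm : Measurable q) (hqi : Integrable q) (hq1 : ∫ φ, q φ = 1)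
    (hlight : ∀ η : ℝ, 0 < η → ∃ φ, gibbsZ J lam * q φ ≤ η * gibbsWeight J lam φ) :
    haveI := isProbabilityMeasure_flowModel hq0 hqi hq1
    ¬ ∃ r : ℝ, r < 1 ∧ ∀ (μ : Measure (Fin (n + 1) → ℝ)) [IsProbabilityMeasure μ] (t : ℕ)
        (A : Set (Fin (n + 1) → ℝ)),
        |((fun ν : Measure (Fin (n + 1) → ℝ) => ν.bind (phi4FlowKernel J lam q))^[t] μ).real A
            - (phi4GibbsMeasure J lam).real A| ≤ r ^ t := by
  haveI := isProbabilityMeasure_flowModel hq0 hqi hq1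
  rintro ⟨r, hr1, hr⟩
  obtain ⟨φ1⟩ : Nonempty (Fin (n + 1) → ℝ) := ⟨fun _ => 0⟩
  -- `r ≥ 0`: apply the bound at `t = 1`
  have hr0 : 0 ≤ r := by
    have h := hr (Measure.dirac φ1) 1 Set.univ
    rw [pow_one] at h
    exact (abs_nonneg _).trans h
  -- pick `t` with `r^t < 1/2`, then `η = 1/(4t)` and a configuration with `ρ ≤ η`
  obtain ⟨t, ht⟩ := exists_pow_lt_of_lt_one (show (0 : ℝ) < 1 / 2 by norm_num) hr1
  have ht0 : 0 < t := by
    rcases Nat.eq_zero_or_pos t with h | h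
    · rw [h, pow_zero] at ht; norm_num at ht
    · exact h
  have htpos : (0 : ℝ) < t := by exact_mod_cast ht0
  obtain ⟨φ₀, hφ₀⟩ := hlight (1 / (4 * t)) (by positivity)
  have hρ : gibbsZ J lam * q φ₀ / gibbsWeight J lam φ₀ ≤ 1 / (4 * t) :=
    (div_le_iff₀ (gibbsWeight_pos J lam φ₀)).2 hφ₀
  have hstick := phi4FlowSampler_sticking_linear hlam J hq0 hqm hqi hq1 φ₀ t
  have hπ : (phi4GibbsMeasure J lam).real {φ₀} = 0 := by
    rw [Measure.real, phi4GibbsMeasure_singleton, ENNReal.toReal_zero]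
  have hbound := hr (Measure.dirac φ₀) t {φ₀}
  rw [hπ, sub_zero] at hbound
  have h34 : (3 : ℝ) / 4 ≤ 1 - t * (gibbsZ J lam * q φ₀ / gibbsWeight J lam φ₀) := by
    have : t * (gibbsZ J lam * q φ₀ / gibbsWeight J lam φ₀) ≤ t * (1 / (4 * t)) :=
      mul_le_mul_of_nonneg_left hρ htpos.le
    have e : (t : ℝ) * (1 / (4 * t)) = 1 / 4 := by field_simp
    linarith
  have hge : (3 : ℝ) / 4 ≤ |((fun ν : Measure (Fin (n + 1) → ℝ) =>
      ν.bind (phi4FlowKernel J lam q))^[t] (Measure.dirac φ₀)).real {φ₀}| :=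
    (h34.trans hstick).trans (le_abs_self _)
  linarith

end Lattice

end Summit.Ventures.LatticeQCDFlow.Exactness
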